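import Literature.Geometry.Lorentzian.LorentzBoost
import Mathlib.Analysis.SpecialFunctions.Sqrt
import Mathlib.Analysis.InnerProductSpace.Calculus
import Mathlib.Analysis.Calculus.ContDiff.Bounds

/-!
# Route EIHFluxBalance — `InertialRecession`: calculus of pure boosts (smoothness in the velocity, inverse)

Helper file for the crux `stmt-FinalStateConjecture-10166`
(`Summit.FinalStateConjecture.FinalStateConjecture.Theses.EIHFluxBalance.InertialRecession`).

Frame normalisation (file `…SchwarzschildFrame`) replaces a painted Lorentz path `Λ(t)` by the
pure boost `boost(v(t))` of its lab velocity; to feed the flat-chart estimate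
(`tendsto_deviationCk_flat_of_ansatz`, which wants `t ↦ Λ(t)⁻¹` smooth as an operator with
bounded lab-time derivatives) one needs (i) the velocity dependence `v ↦ boostCLM v` to be smooth
on the open unit ball (`contDiffOn_boostCLM`) and (ii) the inverse of a pure boost as an explicit
operator, `boost(v)⁻¹ = boostCLM(−v)` (`boostCLM_neg_apply_boostCLM`, `coe_boost_symm`), so that
`t ↦ boost(v(t))⁻¹ = boostCLM(−v(t))` is a composition of smooth maps (`contDiff_boostCLM_neg_comp`).
Jackson, *Classical Electrodynamics* (3rd ed.), (11.19); O'Neill 1983, Ch. 9, pp. 233–236.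
-/

noncomputable section

open Literature.Geometry.Lorentzian Set Metric
open scoped ContDiff

namespace Summit.FinalStateConjecture.FinalStateConjecture.Theorems

/-- The Lorentz factor `γ(v) = (√(1 − ‖v‖²))⁻¹` is smooth on the open unit ball. [folklore] -/
theorem contDiffOn_lorentzGamma : ContDiffOn ℝ ∞ Lorentz.gamma (ball (0 : E3) 1) := by
  intro v hv
  have hv' : ‖v‖ < 1 := by simpa using hv
  have h1 : 1 - ‖v‖ ^ 2 ≠ 0 := by nlinarith [norm_nonneg v]
  have h2 : ContDiffAt ℝ ∞ (fun w : E3 ↦ 1 - ‖w‖ ^ 2) v :=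
    contDiffAt_const.sub (contDiff_norm_sq ℝ).contDiffAt
  have h3 := h2.sqrt h1
  have h4 : Real.sqrt (1 - ‖v‖ ^ 2) ≠ 0 := Real.sqrt_ne_zero'.mpr (by nlinarith [norm_nonneg v])
  exact (h3.inv h4).contDiffWithinAt

/-- **The pure boost depends smoothly on its velocity**: `v ↦ boostCLM v` is `C^∞` on the open
unit ball of `E3` (it is assembled from `γ(v)`, `innerSL v` and constant operators). [folklore] -/
theorem contDiffOn_boostCLM : ContDiffOn ℝ ∞ Lorentz.boostCLM (ball (0 : E3) 1) := by
  have hγ := contDiffOn_lorentzGamma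
  have hi : ContDiff ℝ ∞ (fun v : E3 ↦ innerSL ℝ v) := (innerSL ℝ (E := E3)).contDiff
  have hden : ∀ v ∈ ball (0 : E3) 1, Lorentz.gamma v + 1 ≠ 0 := by
    intro v hv
    have hv' : ‖v‖ < 1 := by simpa using hv
    have := Lorentz.gamma_pos hv'
    linarith
  unfold Lorentz.boostCLM
  fun_prop (disch := assumption)

/-- `γ(−v) = γ(v)` (bookkeeping). [folklore] -/
theorem lorentzGamma_neg (v : E3) : Lorentz.gamma (-v) = Lorentz.gamma v := by
  unfold Lorentz.gamma
  rw [norm_neg]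

/-- **The boost of the opposite velocity inverts the boost**: `boostCLM(−v) (boostCLM v x) = x`
for `‖v‖ < 1` — the two polynomial identities `γ − 1 − αβ² = 0` and `α(γ + 1) − γ² = 0` for
`α = γ²/(γ+1)`, `γ²(1 − β²) = 1`. Jackson (11.19); O'Neill 1983, Ch. 9. [folklore] -/
theorem boostCLM_neg_apply_boostCLM {v : E3} (hv : ‖v‖ < 1) (x : E4) :
    Lorentz.boostCLM (-v) (Lorentz.boostCLM v x) = x := by
  set γ := Lorentz.gamma v with hγ
  have hγ1 : 1 ≤ γ := Lorentz.one_le_gamma hv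
  have hγ0 : γ + 1 ≠ 0 := by positivity
  have hγne : γ ≠ 0 := by positivity
  have hβ : ‖v‖ ^ 2 = 1 - (γ ^ 2)⁻¹ := by
    have h := Lorentz.gamma_sq_mul hv
    rw [← hγ] at h
    have hγ2 : γ ^ 2 ≠ 0 := by positivity
    field_simp
    linarith
  set s := inner ℝ v (E4.spatial x) with hs
  have hy0 : Lorentz.boostCLM v x 0 = γ * (x 0 + s) := Lorentz.boostCLM_apply_zero v x
  have hys : E4.spatial (Lorentz.boostCLM v x) =
      E4.spatial x + (γ ^ 2 / (γ + 1) * s + γ * x 0) • v := Lorentz.spatial_boostCLM_apply v x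
  have hvy : inner ℝ v (E4.spatial (Lorentz.boostCLM v x)) =
      s + (γ ^ 2 / (γ + 1) * s + γ * x 0) * ‖v‖ ^ 2 := by
    rw [hys, inner_add_right, real_inner_smul_right, real_inner_self_eq_norm_sq, ← hs]
  -- time component
  have hT : Lorentz.boostCLM (-v) (Lorentz.boostCLM v x) 0 = x 0 := by
    rw [Lorentz.boostCLM_apply_zero, lorentzGamma_neg, ← hγ, inner_neg_left, hvy, hy0, hβ]
    field_simp
    ring
  -- space component
  have hS : E4.spatial (Lorentz.boostCLM (-v) (Lorentz.boostCLM v x)) = E4.spatial x := by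
    rw [Lorentz.spatial_boostCLM_apply, lorentzGamma_neg, ← hγ, inner_neg_left, hvy, hy0, hys,
      smul_neg, ← sub_eq_add_neg, add_sub_assoc, ← sub_smul]
    have hcoef : γ ^ 2 / (γ + 1) * s + γ * x 0 - (γ ^ 2 / (γ + 1) *
        -(s + (γ ^ 2 / (γ + 1) * s + γ * x 0) * ‖v‖ ^ 2) + γ * (γ * (x 0 + s))) = 0 := by
      rw [hβ]
      field_simp
      ring
    rw [hcoef, zero_smul, add_zero]
  calc Lorentz.boostCLM (-v) (Lorentz.boostCLM v x)
      = E4.ofTimeSpace (E4.time (Lorentz.boostCLM (-v) (Lorentz.boostCLM v x)))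
          (E4.spatial (Lorentz.boostCLM (-v) (Lorentz.boostCLM v x))) :=
        (E4.ofTimeSpace_time_spatial _).symm
    _ = E4.ofTimeSpace (E4.time x) (E4.spatial x) := by rw [E4.time_apply, E4.time_apply, hT, hS]
    _ = x := E4.ofTimeSpace_time_spatial x

/-- **The inverse of a pure boost is the boost of the opposite velocity, as an operator**:
`(boost v)⁻¹ = boostCLM(−v)`. Jackson (11.19); O'Neill 1983, Ch. 9. [folklore] -/
theorem coe_boost_symm' {v : E3} (hv : ‖v‖ < 1) :
    (((Lorentz.boost v hv : E4 ≃L[ℝ] E4).symm : E4 →L[ℝ] E4)) = Lorentz.boostCLM (-v) := by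
  refine ContinuousLinearMap.ext fun y ↦ ?_
  have h1 : (Lorentz.boost v hv : E4 ≃L[ℝ] E4) ((Lorentz.boost v hv : E4 ≃L[ℝ] E4).symm y) = y :=
    (Lorentz.boost v hv : E4 ≃L[ℝ] E4).apply_symm_apply y
  rw [Lorentz.coe_boost_apply] at h1
  have h2 := congrArg (Lorentz.boostCLM (-v)) h1
  rw [boostCLM_neg_apply_boostCLM hv] at h2
  exact h2

/-- **Smooth inverse frames from a smooth subluminal velocity path**: if `w : ℝ → E3` is `Cⁿ` with
`‖w(t)‖ < 1` for all `t`, then `t ↦ boostCLM(−w(t))` (`= boost(w(t))⁻¹`) is `Cⁿ` — the operator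
path required of `Λ⁻¹` by the flat-chart estimate. [folklore] -/
theorem contDiff_boostCLM_neg_comp {w : ℝ → E3} {n : ℕ∞} (hw : ContDiff ℝ n w)
    (hw1 : ∀ t, ‖w t‖ < 1) : ContDiff ℝ n fun t ↦ Lorentz.boostCLM (-w t) := by
  have h1 : ContDiff ℝ n fun t ↦ -w t := hw.neg
  have hmaps : ∀ t, -w t ∈ ball (0 : E3) 1 := fun t ↦ by simpa using hw1 t
  rw [contDiff_iff_contDiffAt]
  intro t
  have h2 : ContDiffAt ℝ ∞ Lorentz.boostCLM (-w t) :=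
    (contDiffOn_boostCLM (-w t) (hmaps t)).contDiffAt (isOpen_ball.mem_nhds (hmaps t))
  exact (h2.of_le (by exact_mod_cast le_top)).comp t h1.contDiffAt

/-! ### Uniform derivative bounds for normalised frame paths -/

-- operator-valued multilinear maps: the instance path is slow
set_option synthInstance.maxHeartbeats 200000 in
/-- **Derivatives of the inverse normalised frame are bounded by those of the velocity.** For every
order `k`, speed bound `κ₀ < 1` and size `Γ` there is `Γ'` such that for every `Cᵏ` velocity path
`w` with `‖w‖ ≤ κ₀` everywhere and `‖w⁽ʲ⁾(t)‖ ≤ Γ` (`1 ≤ j ≤ k`): `‖(s ↦ boostCLM(−w(s)))⁽ʲ⁾(t)‖ ≤ Γ'`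
for all `j ≤ k` (Faà di Bruno with the derivatives of `u ↦ boostCLM(−u)` bounded on the compact
ball `‖u‖ ≤ κ₀` by continuity). This is the hypothesis `‖(Λ⁻¹)⁽ʲ⁾‖ ≤ Γ'` of the flat-chart estimate
for the normalised frame `Λ(t) = boost(w(t))`. [folklore] -/
theorem exists_bound_iteratedDeriv_boostCLM_neg_comp (k : ℕ) {κ₀ : ℝ} (hκ₀ : κ₀ < 1) (Γ : ℝ) :
    ∃ Γ' : ℝ, ∀ (w : ℝ → E3) (t : ℝ), ContDiff ℝ k w → (∀ s, ‖w s‖ ≤ κ₀) →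
      (∀ j, 1 ≤ j → j ≤ k → ‖iteratedDeriv j w t‖ ≤ Γ) →
      ∀ j ≤ k, ‖iteratedDeriv j (fun s ↦ Lorentz.boostCLM (-w s)) t‖ ≤ Γ' := by
  -- the smooth map `g u = boostCLM (−u)` on the open unit ball
  set g : E3 → E4 →L[ℝ] E4 := fun u ↦ Lorentz.boostCLM (-u) with hg
  have hgc : ContDiffOn ℝ ∞ g (ball (0 : E3) 1) := by
    refine contDiffOn_boostCLM.comp contDiff_neg.contDiffOn fun u hu ↦ ?_
    simpa using hu
  have hOo : IsOpen (ball (0 : E3) 1) := isOpen_ball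
  -- bounds for `D^i g` on the compact ball `‖u‖ ≤ κ₀`
  have hKc : IsCompact (closedBall (0 : E3) κ₀) := isCompact_closedBall _ _
  have hKO : closedBall (0 : E3) κ₀ ⊆ ball 0 1 := closedBall_subset_ball hκ₀
  have hbound : ∀ i : ℕ, ∃ C : ℝ, ∀ u ∈ closedBall (0 : E3) κ₀, ‖iteratedFDeriv ℝ i g u‖ ≤ C := by
    intro i
    have h1 := hgc.continuousOn_iteratedFDerivWithin (m := i) (by exact_mod_cast le_top)
      hOo.uniqueDiffOn
    have h2 := h1.congr (g := iteratedFDeriv ℝ i g)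
      fun p hp ↦ (iteratedFDerivWithin_of_isOpen i hOo hp).symm
    obtain ⟨C, hC⟩ := hKc.exists_bound_of_continuousOn (h2.mono hKO)
    exact ⟨C, hC⟩
  choose C hC using hbound
  set Cmax : ℝ := ∑ i ∈ Finset.range (k + 1), |C i| with hCmax
  have hCi : ∀ i ≤ k, ∀ u ∈ closedBall (0 : E3) κ₀, ‖iteratedFDeriv ℝ i g u‖ ≤ Cmax :=
    fun i hi u hu ↦ ((hC i u hu).trans (le_abs_self _)).trans
      (Finset.single_le_sum (f := fun i ↦ |C i|) (fun _ _ ↦ abs_nonneg _)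
        (Finset.mem_range.mpr (Nat.lt_succ_of_le hi)))
  set D : ℝ := max Γ 1 with hD
  refine ⟨(k.factorial : ℝ) * Cmax * D ^ k, fun w t hw hws hwb j hj ↦ ?_⟩
  have hCmax0 : 0 ≤ Cmax := Finset.sum_nonneg fun _ _ ↦ abs_nonneg _
  have hD1 : 1 ≤ D := le_max_right _ _
  have hwt : w t ∈ closedBall (0 : E3) κ₀ := by simpa using hws t
  -- Faà di Bruno on the open preimage of the unit ball
  set s : Set ℝ := w ⁻¹' ball (0 : E3) 1 with hs
  have hso : IsOpen s := hOo.preimage hw.continuous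
  have hts : t ∈ s := hKO hwt
  have hcomp := norm_iteratedFDerivWithin_comp_le (g := g) (f := w) (n := j)
    (N := ((k : ℕ∞) : WithTop ℕ∞)) (x := t) (hgc.of_le (by exact_mod_cast le_top)) hw.contDiffOn
    (by exact_mod_cast hj) hOo.uniqueDiffOn hso.uniqueDiffOn (fun y hy ↦ hy) hts (C := Cmax) (D := D)
    (fun i hi ↦ by
      rw [iteratedFDerivWithin_of_isOpen i hOo (hKO hwt)]
      exact hCi i (hi.trans hj) (w t) hwt)
    (fun i hi1 hij ↦ by
      rw [iteratedFDerivWithin_of_isOpen i hso hts, norm_iteratedFDeriv_eq_norm_iteratedDeriv]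
      exact ((hwb i hi1 (hij.trans hj)).trans (le_max_left _ _)).trans
        (le_self_pow₀ hD1 (by omega)))
  rw [iteratedFDerivWithin_of_isOpen j hso hts] at hcomp
  rw [← norm_iteratedFDeriv_eq_norm_iteratedDeriv]
  refine hcomp.trans ?_
  have h1 : (j.factorial : ℝ) ≤ k.factorial := by exact_mod_cast Nat.factorial_le hj
  have h2 : D ^ j ≤ D ^ k := pow_le_pow_right₀ hD1 hj
  exact mul_le_mul (mul_le_mul_of_nonneg_right h1 hCmax0) h2 (by positivity) (by positivity)

/-- Registered sub-goal form (stub `coe_boost_symm` of the crux item) of `coe_boost_symm'`.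
[folklore] -/
theorem coe_boost_symm : open Literature.Geometry.Lorentzian in ∀ {v : E3} (hv : ‖v‖ < 1), (((Lorentz.boost v hv : E4 ≃L[ℝ] E4).symm : E4 →L[ℝ] E4)) = Lorentz.boostCLM (-v) :=
  fun hv ↦ coe_boost_symm' hv

end Summit.FinalStateConjecture.FinalStateConjecture.Theorems

end
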